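import Literature.MathematicalPhysics.QuantumFieldTheory.ConformalBootstrap3D.MixedPointTable
import Literature.MathematicalPhysics.QuantumFieldTheory.ConformalBootstrap3D.HRCoeffABBoundTables

/-!
# Mixed `σ–ε` certificates: light-block cells that START AT THE UNITARITY BOUND

The interval-table cells of `MixedEvenHead` / `MixedOddHead` need a cell `[a, b)` with
`a > unitarityBound3D ℓ`; a spinning row of the `σ–ε` system (`ℓ ≥ 1` in the odd sector, even
`ℓ ≥ 2` in the even sector, operators allowed from the bound `Δ = ℓ + 1` on) therefore cannot be
covered by them near the bound — which made the spin-row hypotheses of `boxExcluded_of_mixedPointTable`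
jointly unsatisfiable for `ℓ + 1 < E₀`. This file supplies the BOUND CELLS:
* EVEN sector: the same `2×2` head argument with the MONOTONE equal-dimension tables
  `A_{n,j}(Δ) ∈ [A_{n,j}(a)·π(a)/π(b), A_{n,j}(b)·π(b)/π(a)]` (`hrCoeff_mem_Icc_cell`, valid from
  `a = ℓ + 1`): `evenPositive_ofPoints_of_headSumsM[_Ico]`, numbers `evenHeadXM/YM/ZM`,
  cell theorem `evenCellM_of_headNumbers (ha : ℓ + 1 ≤ a)`;
* ODD sector (`ℓ ≥ 1`): the `gpm` array `A(c,c)` has a simple pole at the bound, so the head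
  inequality is certified for the RESCALED block `(Δ-ℓ-1)·𝔇[gpm]` with the finite tables
  `hrCoeffABBdLo/Hi` of `HRCoeffABBoundTables` (`(Δ-ℓ-1)·A_{n,j}(c,c) ∈ [Lo, Hi]`, `Lo ≥ 0`); the
  positive factor is divided out at each regular `Δ > ℓ + 1` and the bound itself is reached by the
  right-limit clause: `oddPositive_ofPoints_of_headSumBd[_Ico]`, number `oddHeadNumberBd`, cell
  theorem `oddCellBd_of_headNumber (hℓ : 1 ≤ ℓ) (ha : ℓ + 1 ≤ a)`.
The tail arguments (rules (M)/(T), apex domination) are unchanged.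
[cite: KosPolandSimmonsduffin2014, §3.3 eq. (3.16)] [cite: DolanOsborn2004, §3 eq. (3.11)]
[cite: HogervorstRychkov2013, §3 eq. (3.9)]
-/

noncomputable section

namespace Literature.MathematicalPhysics.QuantumFieldTheory.ConformalBootstrap3D

open Finset Set Filter Topology

/-- For `ℓ ≥ 1` the unitarity bound is `ℓ + 1`. [cite: HogervorstRychkov2013, §2] -/
theorem unitarityBound3D_of_one_le {ℓ : ℕ} (hℓ : 1 ≤ ℓ) : unitarityBound3D ℓ = (ℓ : ℝ) + 1 := by
  unfold unitarityBound3D; rw [if_neg (by omega)]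

/-! ### Even sector: monotone tables -/

/-- Monotone lower table `A_{n,j}(a)·π_n(a)/π_n(b)`. [cite: HogervorstRychkov2013, §3 eq. (3.9)] -/
def hrCoeffMLo (a b : ℝ) (ℓ n j : ℕ) : ℝ := hrCoeff a ℓ n j * (pivotProd a ℓ n / pivotProd b ℓ n)

/-- Monotone upper table `A_{n,j}(b)·π_n(b)/π_n(a)`. [cite: HogervorstRychkov2013, §3 eq. (3.9)] -/
def hrCoeffMHi (a b : ℝ) (ℓ n j : ℕ) : ℝ := hrCoeff b ℓ n j * (pivotProd b ℓ n / pivotProd a ℓ n)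

/-- `0 ≤ MLo ≤ A_{n,j}(Δ) ≤ MHi` on `ℓ + 1 ≤ a ≤ Δ ≤ b`. [cite: HogervorstRychkov2013, §3 eq. (3.9)] -/
theorem hrCoeff_monotone_sandwich {a Δ b : ℝ} {ℓ : ℕ} (ha : (ℓ : ℝ) + 1 ≤ a) (h1 : a ≤ Δ)
    (h2 : Δ ≤ b) (n j : ℕ) :
    0 ≤ hrCoeffMLo a b ℓ n j ∧ hrCoeffMLo a b ℓ n j ≤ hrCoeff Δ ℓ n j ∧
      hrCoeff Δ ℓ n j ≤ hrCoeffMHi a b ℓ n j := by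
  have h := hrCoeff_mem_Icc_cell ha h1 h2 n j
  refine ⟨?_, h.1, h.2⟩
  exact mul_nonneg (hrCoeff_nonneg_of_le ha n j)
    (div_pos (pivotProd_pos ha n) (pivotProd_pos ((ha.trans h1).trans h2) n)).le

/-- Even head sum with the monotone tables: `∑_{q∈F} min(MLo_q Φ_q, MHi_q Φ_q)`.
[cite: KosPolandSimmonsduffin2014, §3.3 eq. (3.16)] -/
def headCellSumM (ℓ : ℕ) (a b : ℝ) (F : Finset (ℕ × ℕ)) (Φlo : ℕ × ℕ → ℝ) : ℝ :=
  ∑ q ∈ F, min (hrCoeffMLo a b ℓ q.1 q.2 * Φlo q) (hrCoeffMHi a b ℓ q.1 q.2 * Φlo q)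

/-- Off-diagonal absolute head sum with the monotone upper table: `∑_{q∈F} MHi_q Z_q`.
[cite: KosPolandSimmonsduffin2014, §3.3 eq. (3.16)] -/
def headAbsSumM (ℓ : ℕ) (a b : ℝ) (F : Finset (ℕ × ℕ)) (Zabs : ℕ × ℕ → ℝ) : ℝ :=
  ∑ q ∈ F, hrCoeffMHi a b ℓ q.1 q.2 * Zabs q

/-- **Even head cell rule down to the bound (regular points).** As
`evenPositive_ofPoints_of_headSumsI`, on a cell `[a, b]` with `a ≥ ℓ + 1` and the monotone tables.
[cite: KosPolandSimmonsduffin2014, §3.3 eq. (3.16)] -/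
theorem evenPositive_ofPoints_of_headSumsM {N : ℕ} (z zb : Fin N → ℝ) (w : Fin 5 → Fin N → ℝ)
    (hz : ∀ k, z k ∈ Ioo (0 : ℝ) 1) (hzb : ∀ k, zb k ∈ Ioo (0 : ℝ) 1) {ℓ : ℕ} {a b Δσ Δε : ℝ}
    (ha : (ℓ : ℝ) + 1 ≤ a) (F : Finset (ℕ × ℕ)) (Φ₁lo Φ₂lo Zabs : ℕ × ℕ → ℝ)
    (hΦ₁ : ∀ q ∈ F, ∀ Δ ∈ Icc a b,
      Φ₁lo q ≤ pointFunctional (w 0) z zb (crossF Δσ (-1) (zMono (Δ + (q.1 : ℝ)) q.2)))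
    (hΦ₂ : ∀ q ∈ F, ∀ Δ ∈ Icc a b,
      Φ₂lo q ≤ pointFunctional (w 1) z zb (crossF Δε (-1) (zMono (Δ + (q.1 : ℝ)) q.2)))
    (hZ : ∀ q ∈ F, ∀ Δ ∈ Icc a b,
      |pointFunctional (w 3) z zb (crossF ((Δσ + Δε) / 2) (-1) (zMono (Δ + (q.1 : ℝ)) q.2)) +
        pointFunctional (w 4) z zb (crossF ((Δσ + Δε) / 2) 1 (zMono (Δ + (q.1 : ℝ)) q.2))| ≤ Zabs q)
    (hX : 0 ≤ headCellSumM ℓ a b F Φ₁lo) (hY : 0 ≤ headCellSumM ℓ a b F Φ₂lo)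
    (hdet : headAbsSumM ℓ a b F Zabs ^ 2 ≤ 4 * headCellSumM ℓ a b F Φ₁lo * headCellSumM ℓ a b F Φ₂lo)
    (htail : ∀ q : ℕ × ℕ, q ∉ F → InDescendantRange ℓ q.1 q.2 →
      ∀ E ∈ Icc (a + q.1) (b + q.1), ∀ x y : ℝ, 0 ≤ evenTermForm z zb w Δσ Δε E q.2 x y) :
    ∀ Δ ∈ Icc a b, IsRegularPoint3D Δ ℓ →
      (CrossingFunctional.ofPoints z zb w).EvenPositive Δσ Δε Δ ℓ := by
  intro Δ hΔ hreg
  have hbd : unitarityBound3D ℓ ≤ Δ := ((unitarityBound3D_le_add_one ℓ).trans ha).trans hΔ.1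
  have hlt : unitarityBound3D ℓ < Δ := lt_of_le_of_ne hbd (fun h => hreg.1 h.symm)
  have hlam : 0 < legendreLam ℓ := legendreLam_pos ℓ
  refine evenPositive_ofPoints_of_termwise z zb w hz hzb hlt hreg.2 F ?_ ?_
  · intro x y
    rw [sum_evenTermForm_eq]
    set c : ℕ × ℕ → ℝ := fun q => hrCoeff Δ ℓ q.1 q.2 / legendreLam ℓ with hc
    set X := ∑ q ∈ F, c q * pointFunctional (w 0) z zb (crossF Δσ (-1) (zMono (Δ + (q.1 : ℝ)) q.2))
    set Y := ∑ q ∈ F, c q * pointFunctional (w 1) z zb (crossF Δε (-1) (zMono (Δ + (q.1 : ℝ)) q.2))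
    set W := ∑ q ∈ F, c q *
        (pointFunctional (w 3) z zb (crossF ((Δσ + Δε) / 2) (-1) (zMono (Δ + (q.1 : ℝ)) q.2)) +
          pointFunctional (w 4) z zb (crossF ((Δσ + Δε) / 2) 1 (zMono (Δ + (q.1 : ℝ)) q.2)))
    have hA : ∀ q : ℕ × ℕ, 0 ≤ hrCoeffMLo a b ℓ q.1 q.2 ∧ hrCoeffMLo a b ℓ q.1 q.2 ≤ hrCoeff Δ ℓ q.1 q.2 ∧
        hrCoeff Δ ℓ q.1 q.2 ≤ hrCoeffMHi a b ℓ q.1 q.2 :=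
      fun q => hrCoeff_monotone_sandwich ha hΔ.1 hΔ.2 q.1 q.2
    have hXlo : headCellSumM ℓ a b F Φ₁lo / legendreLam ℓ ≤ X := by
      rw [headCellSumM, Finset.sum_div]
      refine Finset.sum_le_sum fun q hq => ?_
      have hmin := min_mul_le_mul_of_bounds (hA q).2.1 (hA q).2.2 ((hA q).1.trans (hA q).2.1)
        (hΦ₁ q hq Δ hΔ)
      have hrw : c q * pointFunctional (w 0) z zb (crossF Δσ (-1) (zMono (Δ + (q.1 : ℝ)) q.2)) =
          hrCoeff Δ ℓ q.1 q.2 *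
            pointFunctional (w 0) z zb (crossF Δσ (-1) (zMono (Δ + (q.1 : ℝ)) q.2)) /
              legendreLam ℓ := by
        simp only [hc]; ring
      rw [hrw]
      exact div_le_div_of_nonneg_right hmin hlam.le
    have hYlo : headCellSumM ℓ a b F Φ₂lo / legendreLam ℓ ≤ Y := by
      rw [headCellSumM, Finset.sum_div]
      refine Finset.sum_le_sum fun q hq => ?_
      have hmin := min_mul_le_mul_of_bounds (hA q).2.1 (hA q).2.2 ((hA q).1.trans (hA q).2.1)
        (hΦ₂ q hq Δ hΔ)
      have hrw : c q * pointFunctional (w 1) z zb (crossF Δε (-1) (zMono (Δ + (q.1 : ℝ)) q.2)) =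
          hrCoeff Δ ℓ q.1 q.2 *
            pointFunctional (w 1) z zb (crossF Δε (-1) (zMono (Δ + (q.1 : ℝ)) q.2)) /
              legendreLam ℓ := by
        simp only [hc]; ring
      rw [hrw]
      exact div_le_div_of_nonneg_right hmin hlam.le
    have hWabs : |W| ≤ headAbsSumM ℓ a b F Zabs / legendreLam ℓ := by
      rw [headAbsSumM, Finset.sum_div]
      refine (Finset.abs_sum_le_sum_abs _ _).trans (Finset.sum_le_sum fun q hq => ?_)
      rw [abs_mul, abs_of_nonneg (div_nonneg ((hA q).1.trans (hA q).2.1) hlam.le)]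
      have hZq := hZ q hq Δ hΔ
      have hZ0 : 0 ≤ Zabs q := (abs_nonneg _).trans hZq
      calc hrCoeff Δ ℓ q.1 q.2 / legendreLam ℓ * |_| ≤ hrCoeff Δ ℓ q.1 q.2 / legendreLam ℓ * Zabs q :=
            mul_le_mul_of_nonneg_left hZq (div_nonneg ((hA q).1.trans (hA q).2.1) hlam.le)
        _ ≤ hrCoeffMHi a b ℓ q.1 q.2 * Zabs q / legendreLam ℓ := by
            rw [div_mul_eq_mul_div]
            exact div_le_div_of_nonneg_right (mul_le_mul_of_nonneg_right (hA q).2.2 hZ0) hlam.le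
    have hX0 : 0 ≤ headCellSumM ℓ a b F Φ₁lo / legendreLam ℓ := div_nonneg hX hlam.le
    have hY0 : 0 ≤ headCellSumM ℓ a b F Φ₂lo / legendreLam ℓ := div_nonneg hY hlam.le
    have hXpos : 0 ≤ X := hX0.trans hXlo
    have hYpos : 0 ≤ Y := hY0.trans hYlo
    refine quadForm_nonneg_of_det hXpos hYpos ?_ x y
    have hW2 : W ^ 2 ≤ (headAbsSumM ℓ a b F Zabs / legendreLam ℓ) ^ 2 := by
      have h1 : -(headAbsSumM ℓ a b F Zabs / legendreLam ℓ) ≤ W := by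
        linarith [neg_abs_le W]
      exact sq_le_sq' h1 ((le_abs_self W).trans hWabs)
    have hdet' : (headAbsSumM ℓ a b F Zabs / legendreLam ℓ) ^ 2 ≤
        4 * (headCellSumM ℓ a b F Φ₁lo / legendreLam ℓ) *
          (headCellSumM ℓ a b F Φ₂lo / legendreLam ℓ) := by
      rw [div_pow]
      have hre : 4 * (headCellSumM ℓ a b F Φ₁lo / legendreLam ℓ) *
          (headCellSumM ℓ a b F Φ₂lo / legendreLam ℓ) =
          4 * headCellSumM ℓ a b F Φ₁lo * headCellSumM ℓ a b F Φ₂lo / legendreLam ℓ ^ 2 := by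
        field_simp
      rw [hre]
      exact div_le_div_of_nonneg_right hdet (sq_nonneg _)
    calc W ^ 2 ≤ (headAbsSumM ℓ a b F Zabs / legendreLam ℓ) ^ 2 := hW2
      _ ≤ 4 * (headCellSumM ℓ a b F Φ₁lo / legendreLam ℓ) *
            (headCellSumM ℓ a b F Φ₂lo / legendreLam ℓ) := hdet'
      _ ≤ 4 * X * Y :=
          mul_le_mul (mul_le_mul_of_nonneg_left hXlo (by norm_num)) hYlo hY0
            (mul_nonneg (by norm_num) hXpos)
  · intro q hq hr x y
    exact htail q hq hr (Δ + (q.1 : ℝ)) ⟨by linarith [hΔ.1], by linarith [hΔ.2]⟩ x y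

/-- **Even head cell rule down to the bound, half-open cell** `[a, b)`, `a ≥ ℓ + 1` (the bound
`Δ = ℓ + 1 = a` itself by the right-limit clause). [cite: KosPolandSimmonsduffin2014, §3.3 eq. (3.16)] -/
theorem evenPositive_ofPoints_of_headSumsM_Ico {N : ℕ} (z zb : Fin N → ℝ) (w : Fin 5 → Fin N → ℝ)
    (hz : ∀ k, z k ∈ Ioo (0 : ℝ) 1) (hzb : ∀ k, zb k ∈ Ioo (0 : ℝ) 1) {ℓ : ℕ} {a b Δσ Δε : ℝ}
    (ha : (ℓ : ℝ) + 1 ≤ a) (F : Finset (ℕ × ℕ)) (Φ₁lo Φ₂lo Zabs : ℕ × ℕ → ℝ)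
    (hΦ₁ : ∀ q ∈ F, ∀ Δ ∈ Icc a b,
      Φ₁lo q ≤ pointFunctional (w 0) z zb (crossF Δσ (-1) (zMono (Δ + (q.1 : ℝ)) q.2)))
    (hΦ₂ : ∀ q ∈ F, ∀ Δ ∈ Icc a b,
      Φ₂lo q ≤ pointFunctional (w 1) z zb (crossF Δε (-1) (zMono (Δ + (q.1 : ℝ)) q.2)))
    (hZ : ∀ q ∈ F, ∀ Δ ∈ Icc a b,
      |pointFunctional (w 3) z zb (crossF ((Δσ + Δε) / 2) (-1) (zMono (Δ + (q.1 : ℝ)) q.2)) +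
        pointFunctional (w 4) z zb (crossF ((Δσ + Δε) / 2) 1 (zMono (Δ + (q.1 : ℝ)) q.2))| ≤ Zabs q)
    (hX : 0 ≤ headCellSumM ℓ a b F Φ₁lo) (hY : 0 ≤ headCellSumM ℓ a b F Φ₂lo)
    (hdet : headAbsSumM ℓ a b F Zabs ^ 2 ≤ 4 * headCellSumM ℓ a b F Φ₁lo * headCellSumM ℓ a b F Φ₂lo)
    (htail : ∀ q : ℕ × ℕ, q ∉ F → InDescendantRange ℓ q.1 q.2 →
      ∀ E ∈ Icc (a + q.1) (b + q.1), ∀ x y : ℝ, 0 ≤ evenTermForm z zb w Δσ Δε E q.2 x y) :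
    ∀ Δ ∈ Ico a b, (CrossingFunctional.ofPoints z zb w).EvenPositive Δσ Δε Δ ℓ := by
  intro Δ hΔ
  have hreg := evenPositive_ofPoints_of_headSumsM z zb w hz hzb ha F Φ₁lo Φ₂lo Zabs hΦ₁ hΦ₂ hZ hX hY
    hdet htail
  by_cases hr : IsRegularPoint3D Δ ℓ
  · exact hreg Δ ⟨hΔ.1, hΔ.2.le⟩ hr
  · have hbd : unitarityBound3D ℓ ≤ Δ := ((unitarityBound3D_le_add_one ℓ).trans ha).trans hΔ.1
    refine evenPositive_ofPoints_of_eventually_right z zb w hz hzb Δσ Δε Δ ℓ hr ?_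
    filter_upwards [eventually_isRegularPoint3D_nhdsGT_of_bound_le hbd, Ioo_mem_nhdsGT hΔ.2]
      with Δ' hΔ'reg hΔ'
    exact ⟨hΔ'reg, hreg Δ' ⟨hΔ.1.trans hΔ'.1.le, hΔ'.2.le⟩ hΔ'reg⟩

/-- Even bound-cell number `X_lo` (monotone tables, `σ`-row corner term bounds).
[cite: KosPolandSimmonsduffin2014, §3.3 eq. (3.16)] -/
def evenHeadXM {N : ℕ} (z zb : Fin N → ℝ) (w : Fin 5 → Fin N → ℝ) (ℓ : ℕ) (a b σlo σhi : ℝ)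
    (nF : ℕ) : ℝ :=
  headCellSumM ℓ a b (headSet ℓ nF)
    (fun q => termCornerBound (w 0) z zb q.2 (a + q.1) (b + q.1) σlo σhi)

/-- Even bound-cell number `Y_lo`. [cite: KosPolandSimmonsduffin2014, §3.3 eq. (3.16)] -/
def evenHeadYM {N : ℕ} (z zb : Fin N → ℝ) (w : Fin 5 → Fin N → ℝ) (ℓ : ℕ) (a b εlo εhi : ℝ)
    (nF : ℕ) : ℝ :=
  headCellSumM ℓ a b (headSet ℓ nF)
    (fun q => termCornerBound (w 1) z zb q.2 (a + q.1) (b + q.1) εlo εhi)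

/-- Even bound-cell number `Z_abs`. [cite: KosPolandSimmonsduffin2014, §3.3 eq. (3.16)] -/
def evenHeadZM {N : ℕ} (z zb : Fin N → ℝ) (w : Fin 5 → Fin N → ℝ) (ℓ : ℕ)
    (a b σlo σhi εlo εhi : ℝ) (nF : ℕ) : ℝ :=
  headAbsSumM ℓ a b (headSet ℓ nF)
    (fun q => offDiagTermAbs z zb w q.2 (a + q.1) (b + q.1) ((σlo + εlo) / 2) ((σhi + εhi) / 2))

/-- **One even light-block cell starting at (or above) `ℓ + 1`, from its three numbers.** As
`evenCell_of_headNumbers` with `ha : ℓ + 1 ≤ a` and the monotone-table numbers.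
[cite: KosPolandSimmonsduffin2014, §3.3 eq. (3.16)] -/
theorem evenCellM_of_headNumbers {N : ℕ} (z zb : Fin N → ℝ) (w : Fin 5 → Fin N → ℝ)
    (hz : ∀ k, z k ∈ Ioo (0 : ℝ) 1) (hzb : ∀ k, zb k ∈ Ioo (0 : ℝ) 1) (hord : ∀ k, zb k ≤ z k)
    (a₀ : Fin N) (qd qr : Fin N → ℝ) (hqd : ∀ k, 0 < qd k ∧ qd k ≤ 1)
    (hqr : ∀ k, 0 < qr k ∧ qr k ≤ 1)
    (hdomd : ∀ k, z k * zb k ≤ qd k ^ 2 * (z a₀ * zb a₀) ∧ z k ≤ qd k * z a₀)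
    (hdomr : ∀ k, (1 - z k) * (1 - zb k) ≤ qr k ^ 2 * (z a₀ * zb a₀) ∧ 1 - zb k ≤ qr k * z a₀)
    {Q : Set (ℝ × ℝ)} {σlo σhi εlo εhi E₀ ET τ : ℝ}
    (hQ : ∀ p ∈ Q, (σlo ≤ p.1 ∧ p.1 ≤ σhi) ∧ (εlo ≤ p.2 ∧ p.2 ≤ εhi))
    (hM : ∀ (j : ℕ) (E : ℝ), E₀ ≤ E → E < ET → (j : ℝ) + τ ≤ E → ∀ p ∈ Q,
      ∀ x y : ℝ, 0 ≤ evenTermForm z zb w p.1 p.2 E j x y)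
    (h0 : 0 ≤ w 0 a₀) (h1 : 0 ≤ w 1 a₀)
    (hX0 : 0 ≤ w 0 a₀ * ((1 - z a₀) * (1 - zb a₀)) ^ σhi - apexRest (w 0) z zb a₀ qd qr σlo ET)
    (hY0 : 0 ≤ w 1 a₀ * ((1 - z a₀) * (1 - zb a₀)) ^ εhi - apexRest (w 1) z zb a₀ qd qr εlo ET)
    (hZ0 : (|w 3 a₀ + w 4 a₀| * ((1 - z a₀) * (1 - zb a₀)) ^ ((σlo + εlo) / 2)
            + apexRest (w 3) z zb a₀ qd qr ((σlo + εlo) / 2) ET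
            + apexRest (w 4) z zb a₀ qd qr ((σlo + εlo) / 2) ET) ^ 2 ≤
        4 * (w 0 a₀ * ((1 - z a₀) * (1 - zb a₀)) ^ σhi - apexRest (w 0) z zb a₀ qd qr σlo ET) *
          (w 1 a₀ * ((1 - z a₀) * (1 - zb a₀)) ^ εhi - apexRest (w 1) z zb a₀ qd qr εlo ET))
    {ℓ : ℕ} {a b : ℝ} (ha : (ℓ : ℝ) + 1 ≤ a) (haτ : (ℓ : ℝ) + τ ≤ a) (nF : ℕ)
    (hnF : E₀ ≤ a + ((nF : ℝ) + 1))
    (hX : 0 ≤ evenHeadXM z zb w ℓ a b σlo σhi nF) (hY : 0 ≤ evenHeadYM z zb w ℓ a b εlo εhi nF)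
    (hdet : evenHeadZM z zb w ℓ a b σlo σhi εlo εhi nF ^ 2 ≤
      4 * evenHeadXM z zb w ℓ a b σlo σhi nF * evenHeadYM z zb w ℓ a b εlo εhi nF) :
    ∀ p ∈ Q, ∀ Δ ∈ Ico a b, (CrossingFunctional.ofPoints z zb w).EvenPositive p.1 p.2 Δ ℓ := by
  intro p hp
  have hT := evenTermForm_nonneg_of_apex z zb w hz hzb hord a₀ qd qr hqd hqr hdomd hdomr h0 h1 hX0
    hY0 hZ0
  refine evenPositive_ofPoints_of_headSumsM_Ico z zb w hz hzb ha (headSet ℓ nF) _ _ _ ?_ ?_ ?_ hX hY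
    hdet ?_
  · intro q _ Δ hΔ
    exact termCornerBound_le (w 0) z zb hz hzb q.2
      (⟨by linarith [hΔ.1], by linarith [hΔ.2]⟩ : Δ + (q.1 : ℝ) ∈ Icc (a + q.1) (b + q.1))
      ⟨(hQ p hp).1.1, (hQ p hp).1.2⟩
  · intro q _ Δ hΔ
    exact termCornerBound_le (w 1) z zb hz hzb q.2
      (⟨by linarith [hΔ.1], by linarith [hΔ.2]⟩ : Δ + (q.1 : ℝ) ∈ Icc (a + q.1) (b + q.1))
      ⟨(hQ p hp).2.1, (hQ p hp).2.2⟩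
  · intro q _ Δ hΔ
    exact abs_sum45_le_offDiagTermAbs z zb w hz hzb q.2
      (⟨by linarith [hΔ.1], by linarith [hΔ.2]⟩ : Δ + (q.1 : ℝ) ∈ Icc (a + q.1) (b + q.1))
      ⟨by linarith [(hQ p hp).1.1, (hQ p hp).2.1], by linarith [(hQ p hp).1.2, (hQ p hp).2.2]⟩
  · intro q hq hr E hE x y
    have h2 : (q.2 : ℝ) ≤ (ℓ : ℝ) + q.1 := by exact_mod_cast hr.2.1
    have hjb : (q.2 : ℝ) + τ ≤ E := by linarith [hE.1]
    have hjE : (q.2 : ℝ) ≤ E := by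
      linarith [hE.1, natCast_add_half_le_unitarityBound3D ℓ, unitarityBound3D_le_add_one ℓ]
    have hE0 : E₀ ≤ E := (headSet_off hnF q hq hr).trans hE.1
    by_cases hET : E < ET
    · exact hM q.2 E hE0 hET hjb p hp x y
    · exact hT E (not_lt.1 hET) q.2 hjE p.1 ⟨(hQ p hp).1.1, (hQ p hp).1.2⟩ p.2
        ⟨(hQ p hp).2.1, (hQ p hp).2.2⟩ x y

/-! ### Odd sector: rescaled head with the bound tables -/

/-- Odd head sum with the bound tables of `(Δ-ℓ-1)·A(c,c)`:
`∑_{q∈F} min(BdLo_q Φ_q, BdHi_q Φ_q)`. [cite: DolanOsborn2004, §3 eq. (3.11)] -/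
def oddHeadCellSumBd (ℓ : ℕ) (c₁ c₂ a b : ℝ) (F : Finset (ℕ × ℕ)) (Φlo : ℕ × ℕ → ℝ) : ℝ :=
  ∑ q ∈ F, min (hrCoeffABBdLo c₁ c₂ a b ℓ q.1 q.2 * Φlo q) (hrCoeffABBdHi c₁ c₂ a b ℓ q.1 q.2 * Φlo q)

/-- **Odd head cell rule down to the bound (regular points).** For `ℓ ≥ 1`, a cell `[a, b]` with
`a ≥ ℓ + 1`, `(Δ_σ-Δ_ε)/2 ∈ [c₁, c₂]`, lower term bounds `Φ_q ≤ 𝔇(E,j)` on the cell,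
`oddHeadCellSumBd ≥ 0` and non-negative dominated tail terms: `OddPositive` at every REGULAR `Δ` of
the cell. The certified inequality is `(Δ-ℓ-1)·(head of 𝔇[gpm]) ≥ 0`; the factor `Δ-ℓ-1 > 0` is
divided out. [cite: DolanOsborn2004, §3 eq. (3.11)] [cite: KosPolandSimmonsduffin2014, §3.3 eq. (3.16)] -/
theorem oddPositive_ofPoints_of_headSumBd {N : ℕ} (z zb : Fin N → ℝ) (w : Fin 5 → Fin N → ℝ)
    (hz : ∀ k, z k ∈ Ioo (0 : ℝ) 1) (hzb : ∀ k, zb k ∈ Ioo (0 : ℝ) 1) {ℓ : ℕ} {a b c₁ c₂ Δσ Δε : ℝ}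
    (hℓ : 1 ≤ ℓ) (ha : (ℓ : ℝ) + 1 ≤ a) (hc1 : c₁ ≤ (Δσ - Δε) / 2) (hc2 : (Δσ - Δε) / 2 ≤ c₂)
    (F : Finset (ℕ × ℕ)) (Φlo : ℕ × ℕ → ℝ)
    (hΦ : ∀ q ∈ F, ∀ Δ ∈ Icc a b, Φlo q ≤ oddDomEval z zb w Δσ (zMono (Δ + (q.1 : ℝ)) q.2))
    (hhead : 0 ≤ oddHeadCellSumBd ℓ c₁ c₂ a b F Φlo)
    (htail : ∀ q : ℕ × ℕ, q ∉ F → InDescendantRange ℓ q.1 q.2 →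
      ∀ E ∈ Icc (a + q.1) (b + q.1), 0 ≤ oddDomEval z zb w Δσ (zMono E q.2)) :
    ∀ Δ ∈ Icc a b, IsRegularPoint3D Δ ℓ →
      (CrossingFunctional.ofPoints z zb w).OddPositive Δσ Δε Δ ℓ := by
  intro Δ hΔ hreg
  have hbd : unitarityBound3D ℓ ≤ Δ := ((unitarityBound3D_le_add_one ℓ).trans ha).trans hΔ.1
  have hlt : unitarityBound3D ℓ < Δ := lt_of_le_of_ne hbd (fun h => hreg.1 h.symm)
  have hx : (ℓ : ℝ) + 1 < Δ := by rw [← unitarityBound3D_of_one_le hℓ]; exact hlt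
  have hκ : 0 < Δ - ℓ - 1 := by linarith
  have hlam : 0 < legendreLam ℓ := legendreLam_pos ℓ
  refine oddPositive_ofPoints_of_dom_head z zb w hz hzb hlt hreg.2 (fun h => absurd h (by omega)) F
    ?_ ?_
  · have hterm : ∀ q ∈ F,
        min (hrCoeffABBdLo c₁ c₂ a b ℓ q.1 q.2 * Φlo q) (hrCoeffABBdHi c₁ c₂ a b ℓ q.1 q.2 * Φlo q) ≤
          ((Δ - ℓ - 1) * legendreLam ℓ) *
            (hrCoeffAB ((Δσ - Δε) / 2) ((Δσ - Δε) / 2) Δ ℓ q.1 q.2 / legendreLam ℓ *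
              oddDomEval z zb w Δσ (zMono (Δ + (q.1 : ℝ)) q.2)) := by
      intro q hq
      obtain ⟨hA0, hAl, hAh⟩ := sub_mul_hrCoeffAB_self_sandwich hℓ ha hΔ.1 hΔ.2 hx hc1 hc2 q.1 q.2
      have hmin := min_mul_le_mul_of_bounds hAl hAh (hA0.trans hAl) (hΦ q hq Δ hΔ)
      have hrw : ((Δ - ℓ - 1) * legendreLam ℓ) *
          (hrCoeffAB ((Δσ - Δε) / 2) ((Δσ - Δε) / 2) Δ ℓ q.1 q.2 / legendreLam ℓ *
            oddDomEval z zb w Δσ (zMono (Δ + (q.1 : ℝ)) q.2)) =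
          ((Δ - ℓ - 1) * hrCoeffAB ((Δσ - Δε) / 2) ((Δσ - Δε) / 2) Δ ℓ q.1 q.2) *
            oddDomEval z zb w Δσ (zMono (Δ + (q.1 : ℝ)) q.2) := by
        field_simp
      rw [hrw]
      exact hmin
    have hsum : 0 ≤ ((Δ - ℓ - 1) * legendreLam ℓ) *
        ∑ q ∈ F, hrCoeffAB ((Δσ - Δε) / 2) ((Δσ - Δε) / 2) Δ ℓ q.1 q.2 / legendreLam ℓ *
          oddDomEval z zb w Δσ (zMono (Δ + (q.1 : ℝ)) q.2) := by
      rw [Finset.mul_sum]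
      calc (0 : ℝ) ≤ oddHeadCellSumBd ℓ c₁ c₂ a b F Φlo := hhead
        _ = ∑ q ∈ F, min (hrCoeffABBdLo c₁ c₂ a b ℓ q.1 q.2 * Φlo q)
              (hrCoeffABBdHi c₁ c₂ a b ℓ q.1 q.2 * Φlo q) := rfl
        _ ≤ _ := Finset.sum_le_sum hterm
    exact (mul_nonneg_iff_of_pos_left (mul_pos hκ hlam)).mp hsum
  · intro q hq hr
    exact htail q hq hr (Δ + (q.1 : ℝ)) ⟨by linarith [hΔ.1], by linarith [hΔ.2]⟩

/-- **Odd head cell rule down to the bound, half-open cell** `[a, b)`, `ℓ ≥ 1`, `a ≥ ℓ + 1` (the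
bound itself by the right-limit clause). [cite: DolanOsborn2004, §3 eq. (3.11)] -/
theorem oddPositive_ofPoints_of_headSumBd_Ico {N : ℕ} (z zb : Fin N → ℝ) (w : Fin 5 → Fin N → ℝ)
    (hz : ∀ k, z k ∈ Ioo (0 : ℝ) 1) (hzb : ∀ k, zb k ∈ Ioo (0 : ℝ) 1) {ℓ : ℕ} {a b c₁ c₂ Δσ Δε : ℝ}
    (hℓ : 1 ≤ ℓ) (ha : (ℓ : ℝ) + 1 ≤ a) (hc1 : c₁ ≤ (Δσ - Δε) / 2) (hc2 : (Δσ - Δε) / 2 ≤ c₂)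
    (F : Finset (ℕ × ℕ)) (Φlo : ℕ × ℕ → ℝ)
    (hΦ : ∀ q ∈ F, ∀ Δ ∈ Icc a b, Φlo q ≤ oddDomEval z zb w Δσ (zMono (Δ + (q.1 : ℝ)) q.2))
    (hhead : 0 ≤ oddHeadCellSumBd ℓ c₁ c₂ a b F Φlo)
    (htail : ∀ q : ℕ × ℕ, q ∉ F → InDescendantRange ℓ q.1 q.2 →
      ∀ E ∈ Icc (a + q.1) (b + q.1), 0 ≤ oddDomEval z zb w Δσ (zMono E q.2)) :
    ∀ Δ ∈ Ico a b, (CrossingFunctional.ofPoints z zb w).OddPositive Δσ Δε Δ ℓ := by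
  intro Δ hΔ
  have hreg := oddPositive_ofPoints_of_headSumBd z zb w hz hzb hℓ ha hc1 hc2 F Φlo hΦ hhead htail
  by_cases hr : IsRegularPoint3D Δ ℓ
  · exact hreg Δ ⟨hΔ.1, hΔ.2.le⟩ hr
  · have hbd : unitarityBound3D ℓ ≤ Δ := ((unitarityBound3D_le_add_one ℓ).trans ha).trans hΔ.1
    refine oddPositive_ofPoints_of_eventually_right z zb w hz hzb Δσ Δε Δ ℓ hr ?_
    filter_upwards [eventually_isRegularPoint3D_nhdsGT_of_bound_le hbd, Ioo_mem_nhdsGT hΔ.2]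
      with Δ' hΔ'reg hΔ'
    exact ⟨hΔ'reg, hreg Δ' ⟨hΔ.1.trans hΔ'.1.le, hΔ'.2.le⟩ hΔ'reg⟩

/-- The odd bound-cell number: `oddHeadCellSumBd` on the canonical head set with the corner term
bounds `cornerBound₂ (w⁴-w⁵-|w³|) (w⁴+w⁵+|w³|)`. [cite: DolanOsborn2004, §3 eq. (3.11)] -/
def oddHeadNumberBd {N : ℕ} (z zb : Fin N → ℝ) (w : Fin 5 → Fin N → ℝ) (ℓ : ℕ)
    (c₁ c₂ a b σlo σhi : ℝ) (nF : ℕ) : ℝ :=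
  oddHeadCellSumBd ℓ c₁ c₂ a b (headSet ℓ nF) (fun q =>
    cornerBound₂ (fun k => w 3 k - w 4 k - |w 2 k|) (fun k => w 3 k + w 4 k + |w 2 k|) z zb q.2
      (a + q.1) (b + q.1) σlo σhi)

/-- **One odd light-block cell of a spinning row starting at (or above) `ℓ + 1`, from its number.**
As `oddCell_of_headNumber` with `ℓ ≥ 1`, `ha : ℓ + 1 ≤ a` and the bound-table number.
[cite: KosPolandSimmonsduffin2014, §3.3 eq. (3.16)] [cite: DolanOsborn2004, §3 eq. (3.11)] -/
theorem oddCellBd_of_headNumber {N : ℕ} (z zb : Fin N → ℝ) (w : Fin 5 → Fin N → ℝ)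
    (hz : ∀ k, z k ∈ Ioo (0 : ℝ) 1) (hzb : ∀ k, zb k ∈ Ioo (0 : ℝ) 1) (hord : ∀ k, zb k ≤ z k)
    (a₀ : Fin N) (qd qr : Fin N → ℝ) (hqd : ∀ k, 0 < qd k ∧ qd k ≤ 1)
    (hqr : ∀ k, 0 < qr k ∧ qr k ≤ 1)
    (hdomd : ∀ k, z k * zb k ≤ qd k ^ 2 * (z a₀ * zb a₀) ∧ z k ≤ qd k * z a₀)
    (hdomr : ∀ k, (1 - z k) * (1 - zb k) ≤ qr k ^ 2 * (z a₀ * zb a₀) ∧ 1 - zb k ≤ qr k * z a₀)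
    {Q : Set (ℝ × ℝ)} {σlo σhi εlo εhi c₁ c₂ E₀ ET τ : ℝ}
    (hQ : ∀ p ∈ Q, (σlo ≤ p.1 ∧ p.1 ≤ σhi) ∧ (εlo ≤ p.2 ∧ p.2 ≤ εhi))
    (hQc : ∀ p ∈ Q, c₁ ≤ (p.1 - p.2) / 2 ∧ (p.1 - p.2) / 2 ≤ c₂)
    (hModd : ∀ (j : ℕ) (E : ℝ), E₀ ≤ E → E < ET → (j : ℝ) + τ ≤ E → ∀ p ∈ Q,
      0 ≤ oddDomEval z zb w p.1 (zMono E j))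
    (hc : 0 ≤ w 3 a₀ - w 4 a₀ - |w 2 a₀|)
    (hTodd : apexRest (w 3) z zb a₀ qd qr σlo ET + apexRest (w 4) z zb a₀ qd qr σlo ET +
        apexRest (fun k => |w 2 k|) z zb a₀ qd qr σlo ET ≤
      (w 3 a₀ - w 4 a₀ - |w 2 a₀|) * ((1 - z a₀) * (1 - zb a₀)) ^ σhi)
    {ℓ : ℕ} {a b : ℝ} (hℓ : 1 ≤ ℓ) (ha : (ℓ : ℝ) + 1 ≤ a) (haτ : (ℓ : ℝ) + τ ≤ a) (nF : ℕ)
    (hnF : E₀ ≤ a + ((nF : ℝ) + 1))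
    (hnum : 0 ≤ oddHeadNumberBd z zb w ℓ c₁ c₂ a b σlo σhi nF) :
    ∀ p ∈ Q, ∀ Δ ∈ Ico a b, (CrossingFunctional.ofPoints z zb w).OddPositive p.1 p.2 Δ ℓ := by
  intro p hp
  have hT := oddDomEval_nonneg_of_apex z zb w hz hzb hord a₀ qd qr hqd hqr hdomd hdomr hc hTodd
  refine oddPositive_ofPoints_of_headSumBd_Ico z zb w hz hzb hℓ ha (hQc p hp).1 (hQc p hp).2
    (headSet ℓ nF) _ ?_ hnum ?_
  · intro q _ Δ hΔ
    rw [oddDomEval_eq_twoWeightEval]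
    exact cornerBound₂_le _ _ z zb hz hzb q.2
      (⟨by linarith [hΔ.1], by linarith [hΔ.2]⟩ : Δ + (q.1 : ℝ) ∈ Icc (a + q.1) (b + q.1))
      ⟨(hQ p hp).1.1, (hQ p hp).1.2⟩
  · intro q hq hr E hE
    have h2 : (q.2 : ℝ) ≤ (ℓ : ℝ) + q.1 := by exact_mod_cast hr.2.1
    have hjb : (q.2 : ℝ) + τ ≤ E := by linarith [hE.1]
    have hjE : (q.2 : ℝ) ≤ E := by
      linarith [hE.1, natCast_add_half_le_unitarityBound3D ℓ, unitarityBound3D_le_add_one ℓ]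
    have hE0 : E₀ ≤ E := (headSet_off hnF q hq hr).trans hE.1
    by_cases hET : E < ET
    · exact hModd q.2 E hE0 hET hjb p hp
    · exact hT E (not_lt.1 hET) q.2 hjE p.1 ⟨(hQ p hp).1.1, (hQ p hp).1.2⟩

end Literature.MathematicalPhysics.QuantumFieldTheory.ConformalBootstrap3D
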